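import Summits.CriticalPhenomena.PercolationContinuityZ3.Theorems.PercNearOneGluingNoHeavyLowerTailKnQuestion8CoefficientwiseRootSetKernelRowTwoPrep
import Summits.CriticalPhenomena.PercolationContinuityZ3.Theorems.PercNearOneGluingNoHeavyLowerTailKnQuestion8CoefficientwiseRootSetKernelTop
import HarnessLib

/-!
# The root-set kernel: ROW 2 of RCSET when the target `y` is isolated — prim-lf-2 gen 60

Support file (`--supports stmt-CriticalPhenomena-4575`, closed), prover `prim-lf-2` (gen 60).  No definitions, no named facts, no sorries; standard axioms.
Memo `prim-lf-2/CW-ATOM-gen60.md` §5; companions `…RootSetKernelTop.lean` (`rcset_top_row`), `…RootSetKernelRowTwoIsolated.lean` (the twin statement with `q` isolated),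
`…RootSetKernelRowTwo{,NonAdj,NoAq,NoBy}.lean` (the other cases of row 2).

Kernel notation: `R_A(t) = {v | ∃ a ∈ A, v ∈ C_a(t)}`, `B_A(t) = R_A(E ∖ t)`, `Φ(A,A') = Σ_{t ⊆ E : ¬(y∈R_A(t) ∧ y∈B_{A'}(t))} T(R_A(t), B_{A'}(t))`.
* `Coefficientwise.rcset_row_two_yIsolated` — **ROW 2 of RCSET when `y` has no non-loop edge**: `Φ(U,U) ≤ 2·Φ(S,U)` (`U = V ∖ {y,q}`, `y,q ∉ S`).  Then `y` is in no cluster, every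
  colouring is admissible, and the row is the TOP ROW OF THE TARGET `q` (`rcset_top_row` with `y := q`) for the monotone functions `X ↦ f(X ∖ y)`, `X ↦ g(X ∖ y)`: the colourings
  with `q` red- and blue-joined to `U` contribute `0` to `Φ(U,U)` (both clusters equal `U + q`) and `≥ 0` to `Φ(S,U)` (`R_S ⊆ U + q = B_U`).
[cite: KozmaNitzan2024, Questions 8–9 (§5.5 p. 36) (context: the Question-8 pocket covariance programme)]
-/

namespace Summit.CriticalPhenomena.PercolationContinuityZ3.Theorems

open Finset Literature.Probability.Percolation

namespace Coefficientwise

variable {ι V : Type*}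

open Classical in
/-- **Row 2 of RCSET when `y` is isolated** (see the module docstring): for finite `V`, `y ≠ q`, `U = V ∖ {y, q}`, `y, q ∉ S`, monotone `f, g`, and no non-loop edge of `E` at `y`:
`Φ(U,U) ≤ 2·Φ(S,U)` for the root-set kernel `Φ` of `(ends, E, y, f, g)`. [cite: KozmaNitzan2024, Questions 8–9 (§5.5 p. 36) (context)] -/
theorem rcset_row_two_yIsolated [Fintype V] [DecidableEq V] (ends : ι → Sym2 V) (E : Finset ι) (y q : V) (hyq : y ≠ q) (S : Finset V) (hyS : y ∉ S) (hqS : q ∉ S)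
    (hy : ∀ i ∈ E, ∀ w : V, w ≠ y → ends i ≠ s(w, y))
    (f g : Set V → ℝ) (hf : Monotone f) (hg : Monotone g) :
    (∑ s ∈ E.powerset.filter (fun s : Finset ι =>
          ¬ ((∃ a ∈ ((Finset.univ : Finset V).erase y).erase q, y ∈ openCluster (ends '' (↑s : Set ι)) a) ∧
             (∃ a ∈ ((Finset.univ : Finset V).erase y).erase q, y ∈ openCluster (ends '' (↑(E \ s) : Set ι)) a))),
        (f {v | ∃ a ∈ ((Finset.univ : Finset V).erase y).erase q, v ∈ openCluster (ends '' (↑s : Set ι)) a} -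
            f {v | ∃ a ∈ ((Finset.univ : Finset V).erase y).erase q, v ∈ openCluster (ends '' (↑(E \ s) : Set ι)) a}) *
          (g {v | ∃ a ∈ ((Finset.univ : Finset V).erase y).erase q, v ∈ openCluster (ends '' (↑s : Set ι)) a} -
            g {v | ∃ a ∈ ((Finset.univ : Finset V).erase y).erase q, v ∈ openCluster (ends '' (↑(E \ s) : Set ι)) a})) ≤
    2 * ∑ s ∈ E.powerset.filter (fun s : Finset ι =>
          ¬ ((∃ a ∈ S, y ∈ openCluster (ends '' (↑s : Set ι)) a) ∧
             (∃ a ∈ ((Finset.univ : Finset V).erase y).erase q, y ∈ openCluster (ends '' (↑(E \ s) : Set ι)) a))),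
        (f {v | ∃ a ∈ S, v ∈ openCluster (ends '' (↑s : Set ι)) a} -
            f {v | ∃ a ∈ ((Finset.univ : Finset V).erase y).erase q, v ∈ openCluster (ends '' (↑(E \ s) : Set ι)) a}) *
          (g {v | ∃ a ∈ S, v ∈ openCluster (ends '' (↑s : Set ι)) a} -
            g {v | ∃ a ∈ ((Finset.univ : Finset V).erase y).erase q, v ∈ openCluster (ends '' (↑(E \ s) : Set ι)) a}) := by
  -- notation
  set U : Finset V := ((Finset.univ : Finset V).erase y).erase q with hU
  set W : Finset V := (Finset.univ : Finset V).erase q with hW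
  set RU : Finset ι → Set V := fun t => {v | ∃ a ∈ U, v ∈ openCluster (ends '' (↑t : Set ι)) a} with hRU
  set RS : Finset ι → Set V := fun t => {v | ∃ a ∈ S, v ∈ openCluster (ends '' (↑t : Set ι)) a} with hRS
  set RW : Finset ι → Set V := fun t => {v | ∃ a ∈ W, v ∈ openCluster (ends '' (↑t : Set ι)) a} with hRW
  set admU : Finset ι → Prop := fun s => ¬ ((∃ a ∈ U, y ∈ openCluster (ends '' (↑s : Set ι)) a) ∧
      (∃ a ∈ U, y ∈ openCluster (ends '' (↑(E \ s) : Set ι)) a)) with hadmU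
  set admS : Finset ι → Prop := fun s => ¬ ((∃ a ∈ S, y ∈ openCluster (ends '' (↑s : Set ι)) a) ∧
      (∃ a ∈ U, y ∈ openCluster (ends '' (↑(E \ s) : Set ι)) a)) with hadmS
  set TU : Finset ι → ℝ := fun s => (f (RU s) - f (RU (E \ s))) * (g (RU s) - g (RU (E \ s))) with hTU
  set TS : Finset ι → ℝ := fun s => (f (RS s) - f (RU (E \ s))) * (g (RS s) - g (RU (E \ s))) with hTS
  change ∑ s ∈ E.powerset.filter admU, TU s ≤ 2 * ∑ s ∈ E.powerset.filter admS, TS s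
  have hyU : y ∉ U := fun h => (Finset.mem_erase.mp (Finset.mem_erase.mp h).2).1 rfl
  have hqU : q ∉ U := fun h => (Finset.mem_erase.mp h).1 rfl
  have memU : ∀ v : V, v ≠ q → v ≠ y → v ∈ U := fun v h1 h2 => Finset.mem_erase.mpr ⟨h1, Finset.mem_erase.mpr ⟨h2, Finset.mem_univ v⟩⟩
  have hyW : y ∈ W := Finset.mem_erase.mpr ⟨hyq, Finset.mem_univ y⟩
  have hUW : U ⊆ W := fun v hv => Finset.mem_erase.mpr ⟨(Finset.mem_erase.mp hv).1, Finset.mem_univ v⟩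
  have hSU : (↑S : Set V) ⊆ ↑U := by
    intro v hv
    have hv' := Finset.mem_coe.mp hv
    exact Finset.mem_coe.mpr (memU v (fun h => hqS (h ▸ hv')) (fun h => hyS (h ▸ hv')))
  have hUsubRU : ∀ t, (↑U : Set V) ⊆ RU t := fun t => subset_setCluster ends U t
  -- `y` is never reached from a set not containing it
  have y_notin : ∀ (A : Finset V) (t : Finset ι), y ∉ A → t ⊆ E → y ∉ {v | ∃ a ∈ A, v ∈ openCluster (ends '' (↑t : Set ι)) a} :=
    fun A t hyA ht => not_mem_setCluster_of_isolated ends hyA fun i hi w hwy => hy i (ht hi) w hwy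
  have hyRU : ∀ t : Finset ι, t ⊆ E → y ∉ RU t := fun t ht => y_notin U t hyU ht
  have hyRS : ∀ t : Finset ι, t ⊆ E → y ∉ RS t := fun t ht => y_notin S t hyS ht
  -- the red cluster of `W = U + y` is the red cluster of `U` plus `y`
  have RW_eq : ∀ t : Finset ι, t ⊆ E → RW t = insert y (RU t) := by
    intro t ht
    ext v
    constructor
    · rintro ⟨a, ha, hva⟩
      by_cases hay : a = y
      · subst hay
        by_cases hvy : v = a
        · exact hvy ▸ Set.mem_insert _ _
        · have hyv : a ∈ {w | ∃ b ∈ ({v} : Finset V), w ∈ openCluster (ends '' (↑t : Set ι)) b} :=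
            ⟨v, Finset.mem_singleton_self v, SimpleGraph.Reachable.symm hva⟩
          exact absurd hyv (y_notin {v} t (fun h => hvy (Finset.mem_singleton.mp h).symm) ht)
      · exact Set.mem_insert_of_mem _ ⟨a, Finset.mem_erase.mpr ⟨(Finset.mem_erase.mp ha).1, Finset.mem_erase.mpr ⟨hay, Finset.mem_univ a⟩⟩, hva⟩
    · intro hv
      rcases Set.mem_insert_iff.mp hv with hv | ⟨a, ha, hva⟩
      · subst hv; exact ⟨_, hyW, mem_openCluster_self _ _⟩
      · exact ⟨a, hUW ha, hva⟩
  -- clusters of `U` and of `S` lie in `U + q`, and contain it as soon as they contain `q`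
  have RU_cases : ∀ t : Finset ι, t ⊆ E → ∀ v, v ∈ RU t → v ≠ q → v ∈ (↑U : Set V) := by
    intro t ht v hv hvq
    have hvy : v ≠ y := fun h => hyRU t ht (h ▸ hv)
    exact Finset.mem_coe.mpr (memU v hvq hvy)
  have RS_sub_RU : ∀ t : Finset ι, RS t ⊆ RU t := by
    rintro t v ⟨a, ha, hva⟩; exact ⟨a, hSU (Finset.mem_coe.mpr ha), hva⟩
  -- the modified functions `X ↦ f(X ∖ y)`
  set fm : Set V → ℝ := fun X => f {v | v ∈ X ∧ v ≠ y} with hfm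
  set gm : Set V → ℝ := fun X => g {v | v ∈ X ∧ v ≠ y} with hgm
  have sub_m : ∀ X X' : Set V, X ⊆ X' → {v | v ∈ X ∧ v ≠ y} ⊆ {v | v ∈ X' ∧ v ≠ y} := fun X X' h v ⟨hv, hvy⟩ => ⟨h hv, hvy⟩
  have hfm_mono : Monotone fm := fun X X' h => hf (sub_m X X' h)
  have hgm_mono : Monotone gm := fun X X' h => hg (sub_m X X' h)
  have strip_insert : ∀ X : Set V, y ∉ X → {v | v ∈ insert y X ∧ v ≠ y} = X := by
    intro X hyX; ext v; constructor
    · rintro ⟨hv, hvy⟩; exact (Set.mem_insert_iff.mp hv).resolve_left hvy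
    · intro hv; exact ⟨Set.mem_insert_of_mem _ hv, fun h => hyX (h ▸ hv)⟩
  have strip_self : ∀ X : Set V, y ∉ X → {v | v ∈ X ∧ v ≠ y} = X := by
    intro X hyX; ext v; constructor
    · rintro ⟨hv, _⟩; exact hv
    · intro hv; exact ⟨hv, fun h => hyX (h ▸ hv)⟩
  have qRW : ∀ t : Finset ι, t ⊆ E → (q ∈ RW t ↔ q ∈ RU t) := by
    intro t ht; rw [RW_eq t ht, Set.mem_insert_iff]; exact ⟨fun h => h.resolve_left hyq.symm, Or.inr⟩
  -- the top row for the TARGET `q`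
  have top := rcset_top_row ends E q S hqS fm gm hfm_mono hgm_mono
  rw [Finset.sum_filter, Finset.sum_filter] at top
  rw [Finset.sum_filter, Finset.sum_filter]
  -- compare termwise: left side `≤`, right side `≥`
  have hL : ∑ s ∈ E.powerset, (if admU s then TU s else 0) ≤
      ∑ s ∈ E.powerset, (if ¬ ((∃ a ∈ W, q ∈ openCluster (ends '' (↑s : Set ι)) a) ∧ (∃ a ∈ W, q ∈ openCluster (ends '' (↑(E \ s) : Set ι)) a))
        then (fm (RW s) - fm (RW (E \ s))) * (gm (RW s) - gm (RW (E \ s))) else 0) := by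
    refine Finset.sum_le_sum fun t ht => ?_
    have htE : t ⊆ E := Finset.mem_powerset.mp ht
    have hcE : E \ t ⊆ E := Finset.sdiff_subset
    have hadm : admU t := fun h => hyRU t htE h.1
    rw [if_pos hadm]
    by_cases hc : (∃ a ∈ W, q ∈ openCluster (ends '' (↑t : Set ι)) a) ∧ (∃ a ∈ W, q ∈ openCluster (ends '' (↑(E \ t) : Set ι)) a)
    · -- both clusters of `U` equal `U + q`: the term vanishes
      rw [if_neg (not_not.mpr hc)]
      have hq1 : q ∈ RU t := (qRW t htE).mp hc.1
      have hq2 : q ∈ RU (E \ t) := (qRW _ hcE).mp hc.2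
      have h12 : RU t ⊆ RU (E \ t) := by
        intro v hv
        by_cases hvq : v = q
        · exact hvq ▸ hq2
        · exact hUsubRU _ (RU_cases t htE v hv hvq)
      have h21 : RU (E \ t) ⊆ RU t := by
        intro v hv
        by_cases hvq : v = q
        · exact hvq ▸ hq1
        · exact hUsubRU _ (RU_cases _ hcE v hv hvq)
      have heq : RU t = RU (E \ t) := Set.Subset.antisymm h12 h21
      simp only [hTU, heq, sub_self, mul_zero, le_refl]
    · rw [if_pos hc]
      simp only [hTU, hfm, hgm, RW_eq t htE, RW_eq _ hcE, strip_insert _ (hyRU t htE), strip_insert _ (hyRU _ hcE), le_refl]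
  have hR : ∑ s ∈ E.powerset, (if ¬ ((∃ a ∈ S, q ∈ openCluster (ends '' (↑s : Set ι)) a) ∧ (∃ a ∈ W, q ∈ openCluster (ends '' (↑(E \ s) : Set ι)) a))
        then (fm (RS s) - fm (RW (E \ s))) * (gm (RS s) - gm (RW (E \ s))) else 0) ≤
      ∑ s ∈ E.powerset, (if admS s then TS s else 0) := by
    refine Finset.sum_le_sum fun t ht => ?_
    have htE : t ⊆ E := Finset.mem_powerset.mp ht
    have hcE : E \ t ⊆ E := Finset.sdiff_subset
    have hadm : admS t := fun h => hyRS t htE h.1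
    rw [if_pos hadm]
    by_cases hc : (∃ a ∈ S, q ∈ openCluster (ends '' (↑t : Set ι)) a) ∧ (∃ a ∈ W, q ∈ openCluster (ends '' (↑(E \ t) : Set ι)) a)
    · -- `R_S ⊆ U + q = B_U`: the term is `≥ 0`
      rw [if_neg (not_not.mpr hc)]
      have hq2 : q ∈ RU (E \ t) := (qRW _ hcE).mp hc.2
      have hsub : RS t ⊆ RU (E \ t) := by
        intro v hv
        by_cases hvq : v = q
        · exact hvq ▸ hq2
        · exact hUsubRU _ (RU_cases t htE v (RS_sub_RU t hv) hvq)
      simp only [hTS]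
      exact mul_nonneg_of_nonpos_of_nonpos (sub_nonpos.mpr (hf hsub)) (sub_nonpos.mpr (hg hsub))
    · rw [if_pos hc]
      simp only [hTS, hfm, hgm, RW_eq _ hcE, strip_self _ (hyRS t htE), strip_insert _ (hyRU _ hcE), le_refl]
  linarith

end Coefficientwise

end Summit.CriticalPhenomena.PercolationContinuityZ3.Theorems
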